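import Summits.SmoothPoincare4.SmoothPoincare4.Theorems.ConvexBisectionAcyclicBisectionExistsBeltPageTubeColumn
import Summits.SmoothPoincare4.SmoothPoincare4.Theorems.ConvexBisectionAcyclicBisectionExistsHgapTwistRadial
import HarnessLib

/-!
# Hgap ▸ part B (page twisting of the straightened dual framed knot), brick G2-1 (tube side, II):
# the fibre derivative of the attaching tube through a page tube, and the rows of the belt matrix
(wave 6, crux stmt-SmoothPoincare4-10508, line `modp-braid-orbits`, stub `stub_T3_dualPresentation` (T3)
▸ node `Hgap` ▸ part B `helper_Hgap_twisting`; registered sub-goal `helper_beltRows_pageTube`)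

The matrix `M` of the first-order structure of the boundary open book of `X` at the belt circle of the
`j`-th handle (`…HgapTwistRadial.lean`: `dΘ̂_u(0) v = 4 ‖dΦ_{K(v)}‖² ⟪D_v u, n(K v)⟫ = ⟪M u, v⟫`, `D_v` the
fibre derivative of the ATTACHING tube `m' ↦ h̄_j (depthLine v m' 0)` at the core point `v`) is read here
through Z4's page tube `Φ` around the attaching circle `K` (fibre frame `∂_v|₀ Φ (x, v) = v₀ r iK' + v₁ κ rot`)
and the transition matrix `A(x) = CircleTube.fibreDeriv f♭ Φ x` (`f♭ = (h j).boundaryTube`):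

* §1 **the whole fibre derivative of the attaching tube against a second tube**
  (`exists_fderiv_attachingFibre_eq`, Y1's `exists_ambient_attachingFraming_eq` for ALL fibre directions,
  same proof): `D_x m' = c • K'(t) + L (A(x) m')` for `x = e^{2πit}`, some `c ∈ ℝ`;
* §2 **the rows** (`beltRow_eq_pageTube`, registered `helper_beltRows_pageTube`): for `K ⊂ page g c`,
  `4 ‖dΦ_{K x}‖² ⟪D_x m', n(K x)⟫ = κ · (A(x) m')₁` (`pageSlope_coeff_of_pageFrame`): the belt matrix has
  `Mᵀ x = κ · row₂ (A(x))`, the transpose-row datum of the winding count `helper_wind_beltCount`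
  (`…HgapTwistWind.lean`), whose column datum `wind (A e₀) = t_j` and determinant sign `ε = sign det A`
  are Y1's (`pageTwistingLoop_attachingFraming_eq`, `CircleTube.exists_frameSign`).

Everything is proved; no named facts, no `sorry`.  References: A. A. Kosinski, *Differential Manifolds*
(1993), III (3.1) [Kosinski1993]; J. B. Etnyre, T. Fuller, IMRN 2006, Thm. 1 (proof, p. 8) [EtnyreFuller2006].
-/

noncomputable section

set_option linter.dupNamespace false

open scoped Manifold ContDiff Topology
open Set Function Metric Filter Complex

namespace Summit.SmoothPoincare4.SmoothPoincare4.Theorems.AcyclicBisectionExists.ModpBraidOrbits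

open Literature.Topology.FourManifolds Literature.Topology.FourManifolds.LefschetzBase
  Literature.Topology.FourManifolds.HandleAttachingMap Literature.Geometry.Symplectic
  Literature.Topology.PlaneTopology

variable {g : ℕ}

/-! ## §1 The fibre derivative of the attaching tube against a second tube -/

/-- **The fibre derivative of the attaching tube against a second tube, in `ℝ⁴`.**  Let `f` be an attaching
map of a 2-handle on `Base g` with attaching circle `K`, `Φ₂` a tube of `∂ Base g` with the same core as
`Φ₁ = f♭`, `L = ∂_v|₀ (Φ₂ (e^{2πit}, v))` read in `ℝ⁴`, `A` the fibre derivative of the transition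
`Φ₂⁻¹ ∘ Φ₁`.  Then for every fibre direction `m'`,
`∂_v|₀ (f (depthLine x v 0)) (m') = c · K'(t) + L (A(x) m')` for some `c ∈ ℝ` (differentiate `Φ₂ ∘ τ = Φ₁`
along the fibre; the circle slot of `dΦ₂` only contributes multiples of `K'`).  (Y1's
`exists_ambient_attachingFraming_eq` is the case `m' = e₀` read through the handle framing.)
[cite: Kosinski1993, III (3.1)] -/
theorem exists_fderiv_attachingFibre_eq (f : HandleAttachingMap 3 2 (Base g)) {Φ₂ : CircleTube (bBase g).carrier}
    (hcore : ∀ θ, f.boundaryTube.core θ = Φ₂.core θ) (t : ℝ)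
    {L : EuclideanSpace ℝ (Fin 2) →L[ℝ] EuclideanSpace ℝ (Fin 4)}
    (hL : HasFDerivAt (fun v : EuclideanSpace ℝ (Fin 2) => (((bBase g).incl (Φ₂.toHomeo (circlePt t, v)) : Base g)).1) L 0)
    (m' : EuclideanSpace ℝ (Fin 2)) :
    ∃ c : ℝ, fderiv ℝ (fun v : EuclideanSpace ℝ (Fin 2) => (f.toFun (depthLine (circlePt t) v 0)).1) 0 m' =
      c • deriv (ambCurve g f.attachingCircle) t + L (CircleTube.fibreDeriv f.boundaryTube Φ₂ (circlePt t) m') := by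
  -- the tube `Φ₂` read in `ℝ⁴` and its differential `D` at `(x, 0)`, `x = e^{2πit}`  (as in Y1's proof)
  set P : (sphere (0 : EuclideanSpace ℝ (Fin 2)) 1) × EuclideanSpace ℝ (Fin 2) → EuclideanSpace ℝ (Fin 4) :=
    fun q => RegularSublevel.incl (isRegularLevel_rho g) ((bBase g).incl (Φ₂.toHomeo q)) with hP_def
  have hP : ContMDiffAt ((𝓡 1).prod 𝓘(ℝ, EuclideanSpace ℝ (Fin 2))) 𝓘(ℝ, EuclideanSpace ℝ (Fin 4)) ∞ P (circlePt t, 0) :=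
    contMDiffAt_coe_tube Φ₂ (Φ₂.mem_source_zero (circlePt t))
  have hPd : MDifferentiableAt ((𝓡 1).prod 𝓘(ℝ, EuclideanSpace ℝ (Fin 2))) 𝓘(ℝ, EuclideanSpace ℝ (Fin 4)) P (circlePt t, 0) :=
    hP.mdifferentiableAt (by simp)
  set D := mfderiv ((𝓡 1).prod 𝓘(ℝ, EuclideanSpace ℝ (Fin 2))) 𝓘(ℝ, EuclideanSpace ℝ (Fin 4)) P (circlePt t, 0) with hD_def
  -- (i) the fibre slot: `D (0, a) = L a`
  have hfib : ∀ a : EuclideanSpace ℝ (Fin 2),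
      D ((0, a) : TangentSpace ((𝓡 1).prod 𝓘(ℝ, EuclideanSpace ℝ (Fin 2))) ((circlePt t, (0 : EuclideanSpace ℝ (Fin 2))) :
        (sphere (0 : EuclideanSpace ℝ (Fin 2)) 1) × EuclideanSpace ℝ (Fin 2))) = L a := by
    intro a
    have hι : HasMFDerivAt 𝓘(ℝ, EuclideanSpace ℝ (Fin 2)) ((𝓡 1).prod 𝓘(ℝ, EuclideanSpace ℝ (Fin 2)))
        (fun v : EuclideanSpace ℝ (Fin 2) => ((circlePt t, v) : (sphere (0 : EuclideanSpace ℝ (Fin 2)) 1) × EuclideanSpace ℝ (Fin 2))) 0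
        ((0 : EuclideanSpace ℝ (Fin 2) →L[ℝ] TangentSpace (𝓡 1) (circlePt t)).prod (ContinuousLinearMap.id ℝ (EuclideanSpace ℝ (Fin 2)))) :=
      (hasMFDerivAt_const (I := 𝓘(ℝ, EuclideanSpace ℝ (Fin 2))) (I' := 𝓡 1) (circlePt t) 0).prodMk (hasMFDerivAt_id (I := 𝓘(ℝ, EuclideanSpace ℝ (Fin 2))) 0)
    have hc := hPd.hasMFDerivAt.comp 0 hι
    have hc' : HasFDerivAt (fun v : EuclideanSpace ℝ (Fin 2) => P (circlePt t, v))
        (D.comp (((0 : EuclideanSpace ℝ (Fin 2) →L[ℝ] TangentSpace (𝓡 1) (circlePt t)).prod (ContinuousLinearMap.id ℝ (EuclideanSpace ℝ (Fin 2)))))) 0 :=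
      hasMFDerivAt_iff_hasFDerivAt.1 hc
    have hLe := hL.unique hc'
    rw [hLe]
    rfl
  -- (ii) the circle slot: `D (ξ, 0) ∈ ℝ · K'(t)`
  have hcirc : ∀ ξ : TangentSpace (𝓡 1) (circlePt t), ∃ c : ℝ,
      D ((ξ, 0) : TangentSpace ((𝓡 1).prod 𝓘(ℝ, EuclideanSpace ℝ (Fin 2))) ((circlePt t, (0 : EuclideanSpace ℝ (Fin 2))) :
        (sphere (0 : EuclideanSpace ℝ (Fin 2)) 1) × EuclideanSpace ℝ (Fin 2))) = c • deriv (ambCurve g f.attachingCircle) t := by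
    intro ξ
    have hι : HasMFDerivAt (𝓡 1) ((𝓡 1).prod 𝓘(ℝ, EuclideanSpace ℝ (Fin 2)))
        (fun y : sphere (0 : EuclideanSpace ℝ (Fin 2)) 1 => ((y, (0 : EuclideanSpace ℝ (Fin 2))) :
          (sphere (0 : EuclideanSpace ℝ (Fin 2)) 1) × EuclideanSpace ℝ (Fin 2))) (circlePt t)
        ((ContinuousLinearMap.id ℝ (TangentSpace (𝓡 1) (circlePt t))).prod (0 : TangentSpace (𝓡 1) (circlePt t) →L[ℝ] EuclideanSpace ℝ (Fin 2))) :=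
      (hasMFDerivAt_id (I := 𝓡 1) (circlePt t)).prodMk (hasMFDerivAt_const (I := 𝓡 1) (I' := 𝓘(ℝ, EuclideanSpace ℝ (Fin 2))) (0 : EuclideanSpace ℝ (Fin 2)) (circlePt t))
    have hc := hPd.hasMFDerivAt.comp (circlePt t) hι
    have hfun : (P ∘ fun y : sphere (0 : EuclideanSpace ℝ (Fin 2)) 1 => ((y, (0 : EuclideanSpace ℝ (Fin 2))) :
        (sphere (0 : EuclideanSpace ℝ (Fin 2)) 1) × EuclideanSpace ℝ (Fin 2))) =
        fun y => RegularSublevel.incl (isRegularLevel_rho g) (f.attachingCircle y) := by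
      funext y
      show RegularSublevel.incl (isRegularLevel_rho g) ((bBase g).incl (Φ₂.toHomeo (y, 0))) =
        RegularSublevel.incl (isRegularLevel_rho g) (f.attachingCircle y)
      rw [← CircleTube.core_apply, ← hcore y, ← HandleAttachingMap.coe_boundaryTube_core]
      rfl
    rw [hfun] at hc
    set D1 : EuclideanSpace ℝ (Fin 1) := mfderiv 𝓘(ℝ, ℝ) (𝓡 1) circlePt t 1 with hD1_def
    obtain ⟨c, hcξ⟩ := exists_smul_eq_of_ne_zero_fin_one (mfderiv_circlePt_one_ne_zero t) ξ
    refine ⟨c, ?_⟩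
    have hK₄ : ContMDiff (𝓡 1) 𝓘(ℝ, EuclideanSpace ℝ (Fin 4)) ∞ fun y => RegularSublevel.incl (isRegularLevel_rho g) (f.attachingCircle y) :=
      (RegularSublevel.contMDiff_incl (isRegularLevel_rho g)).comp (isSmoothEmbedding_attachingCircle f).contMDiff
    have hDT : mfderiv (𝓡 1) 𝓘(ℝ, EuclideanSpace ℝ (Fin 4)) (fun y => RegularSublevel.incl (isRegularLevel_rho g) (f.attachingCircle y)) (circlePt t) D1 =
        deriv (ambCurve g f.attachingCircle) t := by
      have hcomp := mfderiv_comp t (hK₄.mdifferentiableAt (x := circlePt t) (by simp))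
        (contMDiff_circlePt.mdifferentiableAt (by simp))
      have key := (DFunLike.congr_fun hcomp (1 : ℝ)).symm
      rw [mfderiv_eq_fderiv] at key
      exact key
    have e1 : D ((ξ, 0) : TangentSpace ((𝓡 1).prod 𝓘(ℝ, EuclideanSpace ℝ (Fin 2))) ((circlePt t, (0 : EuclideanSpace ℝ (Fin 2))) :
        (sphere (0 : EuclideanSpace ℝ (Fin 2)) 1) × EuclideanSpace ℝ (Fin 2))) =
        mfderiv (𝓡 1) 𝓘(ℝ, EuclideanSpace ℝ (Fin 4)) (fun y => RegularSublevel.incl (isRegularLevel_rho g) (f.attachingCircle y)) (circlePt t) ξ := by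
      rw [hc.mfderiv]
      rfl
    rw [e1, hcξ]
    have e2 := (mfderiv (𝓡 1) 𝓘(ℝ, EuclideanSpace ℝ (Fin 4)) (fun y => RegularSublevel.incl (isRegularLevel_rho g) (f.attachingCircle y)) (circlePt t)).map_smul c D1
    exact e2.trans (congrArg (fun v : EuclideanSpace ℝ (Fin 4) => c • v) hDT)
  -- (iii) the transition along the fibre: `v ↦ τ (x, v)`, its differential `T`, `(T m').2 = A m'`
  set τ := CircleTube.transition f.boundaryTube Φ₂ with hτ_def
  have hτv : MDifferentiableAt 𝓘(ℝ, EuclideanSpace ℝ (Fin 2)) ((𝓡 1).prod 𝓘(ℝ, EuclideanSpace ℝ (Fin 2)))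
      (fun v : EuclideanSpace ℝ (Fin 2) => τ (circlePt t, v)) 0 :=
    CircleTube.mdifferentiableAt_transition_fibre hcore (circlePt t)
  set T := mfderiv 𝓘(ℝ, EuclideanSpace ℝ (Fin 2)) ((𝓡 1).prod 𝓘(ℝ, EuclideanSpace ℝ (Fin 2)))
      (fun v : EuclideanSpace ℝ (Fin 2) => τ (circlePt t, v)) 0 with hT_def
  have hT2 : (T m').2 = CircleTube.fibreDeriv f.boundaryTube Φ₂ (circlePt t) m' := by
    have hs := hasMFDerivAt_snd (I := 𝓡 1) (I' := 𝓘(ℝ, EuclideanSpace ℝ (Fin 2))) (τ (circlePt t, 0))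
    have hc := hs.comp 0 hτv.hasMFDerivAt
    have e : (T m').2 = mfderiv 𝓘(ℝ, EuclideanSpace ℝ (Fin 2)) 𝓘(ℝ, EuclideanSpace ℝ (Fin 2))
        (Prod.snd ∘ fun v : EuclideanSpace ℝ (Fin 2) => τ (circlePt t, v)) 0 m' := by
      rw [hc.mfderiv]; rfl
    rw [e, mfderiv_eq_fderiv]
    rfl
  -- (iv) the fibre map `G v = P (τ (x, v))` agrees near `0` with the fibre map of `f`, read in `ℝ⁴`
  set G : EuclideanSpace ℝ (Fin 2) → EuclideanSpace ℝ (Fin 4) := fun v => P (τ (circlePt t, v)) with hG_def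
  have hτ0 : τ (circlePt t, 0) = (circlePt t, 0) := CircleTube.transition_zero hcore (circlePt t)
  have hPd' : MDifferentiableAt ((𝓡 1).prod 𝓘(ℝ, EuclideanSpace ℝ (Fin 2))) 𝓘(ℝ, EuclideanSpace ℝ (Fin 4)) P (τ (circlePt t, 0)) := by
    rw [hτ0]; exact hPd
  have hGm := hPd'.hasMFDerivAt.comp 0 hτv.hasMFDerivAt
  have hG : HasFDerivAt G ((mfderiv ((𝓡 1).prod 𝓘(ℝ, EuclideanSpace ℝ (Fin 2))) 𝓘(ℝ, EuclideanSpace ℝ (Fin 4)) P (τ (circlePt t, 0))).comp T) 0 :=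
    hasMFDerivAt_iff_hasFDerivAt.1 hGm
  have hGD : HasFDerivAt G (D.comp T) 0 := by
    have key : ∀ (q : (sphere (0 : EuclideanSpace ℝ (Fin 2)) 1) × EuclideanSpace ℝ (Fin 2))
        (_ : q = ((circlePt t, (0 : EuclideanSpace ℝ (Fin 2))) : (sphere (0 : EuclideanSpace ℝ (Fin 2)) 1) × EuclideanSpace ℝ (Fin 2))),
        HasFDerivAt G ((mfderiv ((𝓡 1).prod 𝓘(ℝ, EuclideanSpace ℝ (Fin 2))) 𝓘(ℝ, EuclideanSpace ℝ (Fin 4)) P q).comp T) 0 →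
        HasFDerivAt G (D.comp T) 0 := by
      intro q e h; subst e; exact h
    exact key _ hτ0 hG
  have hdom : ∀ᶠ v in 𝓝 (0 : EuclideanSpace ℝ (Fin 2)), ((circlePt t, v) : (sphere (0 : EuclideanSpace ℝ (Fin 2)) 1) × EuclideanSpace ℝ (Fin 2)) ∈
      CircleTube.transitionDom f.boundaryTube Φ₂ := by
    have hcont : Continuous fun v : EuclideanSpace ℝ (Fin 2) => ((circlePt t, v) : (sphere (0 : EuclideanSpace ℝ (Fin 2)) 1) × EuclideanSpace ℝ (Fin 2)) :=
      continuous_const.prodMk continuous_id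
    exact hcont.continuousAt (CircleTube.transitionDom_mem_nhds_zero hcore (circlePt t))
  have hev : (fun v : EuclideanSpace ℝ (Fin 2) => (f.toFun (depthLine (circlePt t) v 0)).1) =ᶠ[𝓝 0] G := by
    filter_upwards [hdom] with v hvd
    have e1 := CircleTube.apply_transition hvd
    show RegularSublevel.incl (isRegularLevel_rho g) (f.toFun (depthLine (circlePt t) v 0)) =
      RegularSublevel.incl (isRegularLevel_rho g) ((bBase g).incl (Φ₂.toHomeo (τ (circlePt t, v))))
    exact (congrArg (fun p : (bBase g).carrier => RegularSublevel.incl (isRegularLevel_rho g) ((bBase g).incl p)) e1).symm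
  have hFD : HasFDerivAt (fun v : EuclideanSpace ℝ (Fin 2) => (f.toFun (depthLine (circlePt t) v 0)).1) (D.comp T) 0 :=
    hGD.congr_of_eventuallyEq hev
  -- read the two derivatives along the line `s ↦ s • m'` (avoids `fderiv` of a `TangentSpace`-typed map)
  have hl : HasDerivAt (fun s : ℝ => s • m') m' 0 := by
    simpa using (hasDerivAt_id (0 : ℝ)).smul_const m'
  have hdiff : DifferentiableAt ℝ (fun v : EuclideanSpace ℝ (Fin 2) => (f.toFun (depthLine (circlePt t) v 0)).1) 0 :=
    (contDiffAt_attachingFibre f (circlePt t)).differentiableAt (by simp)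
  have h1 : HasDerivAt (fun s : ℝ => (f.toFun (depthLine (circlePt t) (s • m') 0)).1)
      (fderiv ℝ (fun v : EuclideanSpace ℝ (Fin 2) => (f.toFun (depthLine (circlePt t) v 0)).1) 0 m') 0 :=
    hdiff.hasFDerivAt.comp_hasDerivAt_of_eq (0 : ℝ) hl (by simp)
  have h2 : HasDerivAt (fun s : ℝ => (f.toFun (depthLine (circlePt t) (s • m') 0)).1) ((D.comp T) m') 0 :=
    HasFDerivAt.comp_hasDerivAt_of_eq (x := (0 : ℝ)) (f := fun s : ℝ => s • m') hFD hl (by simp)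
  have hU : fderiv ℝ (fun v : EuclideanSpace ℝ (Fin 2) => (f.toFun (depthLine (circlePt t) v 0)).1) 0 m' = (D.comp T) m' :=
    h1.unique h2
  -- (v) split `T m' = ((T m').1, 0) + (0, A m')`
  obtain ⟨c, hc⟩ := hcirc (T m').1
  refine ⟨c, hU.trans ?_⟩
  have hTab : (T m' : TangentSpace ((𝓡 1).prod 𝓘(ℝ, EuclideanSpace ℝ (Fin 2))) ((circlePt t, (0 : EuclideanSpace ℝ (Fin 2))) :
        (sphere (0 : EuclideanSpace ℝ (Fin 2)) 1) × EuclideanSpace ℝ (Fin 2))) =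
      (((T m').1, 0) : TangentSpace ((𝓡 1).prod 𝓘(ℝ, EuclideanSpace ℝ (Fin 2))) ((circlePt t, (0 : EuclideanSpace ℝ (Fin 2))) :
        (sphere (0 : EuclideanSpace ℝ (Fin 2)) 1) × EuclideanSpace ℝ (Fin 2))) +
      (((0, (T m').2)) : TangentSpace ((𝓡 1).prod 𝓘(ℝ, EuclideanSpace ℝ (Fin 2))) ((circlePt t, (0 : EuclideanSpace ℝ (Fin 2))) :
        (sphere (0 : EuclideanSpace ℝ (Fin 2)) 1) × EuclideanSpace ℝ (Fin 2))) :=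
    Prod.ext (by simp) (by simp)
  have hsum : D (T m') =
      @id (EuclideanSpace ℝ (Fin 4)) (D ((((T m').1, 0)) : TangentSpace ((𝓡 1).prod 𝓘(ℝ, EuclideanSpace ℝ (Fin 2)))
        ((circlePt t, (0 : EuclideanSpace ℝ (Fin 2))) : (sphere (0 : EuclideanSpace ℝ (Fin 2)) 1) × EuclideanSpace ℝ (Fin 2)))) +
      @id (EuclideanSpace ℝ (Fin 4)) (D (((0, (T m').2)) : TangentSpace ((𝓡 1).prod 𝓘(ℝ, EuclideanSpace ℝ (Fin 2)))
        ((circlePt t, (0 : EuclideanSpace ℝ (Fin 2))) : (sphere (0 : EuclideanSpace ℝ (Fin 2)) 1) × EuclideanSpace ℝ (Fin 2)))) := by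
    rw [show D (T m') = D ((((T m').1, 0) : TangentSpace ((𝓡 1).prod 𝓘(ℝ, EuclideanSpace ℝ (Fin 2)))
        ((circlePt t, (0 : EuclideanSpace ℝ (Fin 2))) : (sphere (0 : EuclideanSpace ℝ (Fin 2)) 1) × EuclideanSpace ℝ (Fin 2))) +
      (((0, (T m').2)) : TangentSpace ((𝓡 1).prod 𝓘(ℝ, EuclideanSpace ℝ (Fin 2)))
        ((circlePt t, (0 : EuclideanSpace ℝ (Fin 2))) : (sphere (0 : EuclideanSpace ℝ (Fin 2)) 1) × EuclideanSpace ℝ (Fin 2))))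
      from congrArg D hTab]
    exact D.map_add _ _
  show D (T m') = _
  rw [hsum, hc, hfib, hT2]
  rfl

/-! ## §2 The rows of the belt matrix through a page tube -/

/-- The boundary tube of `f` and a tube `Φ` whose core is the attaching circle have the same core.
[folklore] -/
theorem boundaryTube_core_eq_of_incl_core (f : HandleAttachingMap 3 2 (Base g))
    {Φ : CircleTube (bBase g).carrier} (hΦcore : ∀ ψ, (bBase g).incl (Φ.core ψ) = f.attachingCircle ψ)
    (θ : sphere (0 : EuclideanSpace ℝ (Fin 2)) 1) : f.boundaryTube.core θ = Φ.core θ := by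
  apply Subtype.ext
  rw [HandleAttachingMap.coe_boundaryTube_core]
  exact (hΦcore θ).symm

/-- **The rows of the belt matrix** (brick G2-1, tube side II).  For an attaching map `f` with attaching
circle `K` in the flat page of direction `c` and a page tube `Φ` around `K` with Z4's fibre frame
`∂_v|₀ Φ (e^{2πit}, v) = v₀ r iK'(t) + v₁ κ rot (K t)`, the page-rescaled normal component of the fibre
derivative `D_x` of the attaching tube at `x = e^{2πit}` is the second ROW of the transition matrix:
`4 ‖dΦ_{K x}‖² ⟪D_x m', n (K x)⟫ = κ (A(x) m')₁`, `A = CircleTube.fibreDeriv f♭ Φ`.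
[cite: EtnyreFuller2006, Thm. 1 (proof, p. 8)] -/
theorem beltRow_eq_pageTube (f : HandleAttachingMap 3 2 (Base g)) {c : ℂ} (hc : ‖c‖ = 1)
    (hKc : ∀ θ, f.attachingCircle θ ∈ page g c) {κ r : ℝ} {Φ : CircleTube (bBase g).carrier}
    (hΦcore : ∀ ψ, (bBase g).incl (Φ.core ψ) = f.attachingCircle ψ)
    (hΦder : ∀ t : ℝ, HasFDerivAt (fun v : EuclideanSpace ℝ (Fin 2) =>
        ((bBase g).incl (Φ.toHomeo (circlePt t, v))).1)
      ((EuclideanSpace.proj (𝕜 := ℝ) (0 : Fin 2)).smulRight (r • cplxJ (deriv (ambCurve g f.attachingCircle) t)) +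
        (EuclideanSpace.proj (𝕜 := ℝ) (1 : Fin 2)).smulRight (κ • rotField g (f.attachingCircle (circlePt t)).1)) 0)
    (t : ℝ) (m' : EuclideanSpace ℝ (Fin 2)) :
    4 * (‖dPhiX g (f.attachingCircle (circlePt t)).1‖ ^ 2 + ‖dPhiY (f.attachingCircle (circlePt t)).1‖ ^ 2) *
        inner ℝ (fderiv ℝ (fun v : EuclideanSpace ℝ (Fin 2) => (f.toFun (depthLine (circlePt t) v 0)).1) 0 m')
          (horizNormal g (f.attachingCircle (circlePt t)).1) =
      κ * (CircleTube.fibreDeriv f.boundaryTube Φ (circlePt t) m') 1 := by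
  have hcore : ∀ θ, f.boundaryTube.core θ = Φ.core θ := boundaryTube_core_eq_of_incl_core f hΦcore
  obtain ⟨c₀, hc₀⟩ := exists_fderiv_attachingFibre_eq f hcore t (hΦder t) m'
  set a := CircleTube.fibreDeriv f.boundaryTube Φ (circlePt t) m' with ha
  have hq : (f.attachingCircle (circlePt t)).1 = ambCurve g f.attachingCircle t := rfl
  have hKd : MDifferentiableAt (𝓡 1) (𝓡∂ 4) f.attachingCircle (circlePt t) :=
    (isSmoothEmbedding_attachingCircle f).contMDiff.mdifferentiableAt (by simp)
  have hT : dPhiX g (f.attachingCircle (circlePt t)).1 * cx (deriv (ambCurve g f.attachingCircle) t) +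
      dPhiY (f.attachingCircle (circlePt t)).1 * cy (deriv (ambCurve g f.attachingCircle) t) = 0 :=
    dPhi_velocity_eq_zero_of_page hKc (hasDerivAt_ambCurve (g := g) hKd).differentiableAt.hasDerivAt
  have hw : w g (f.attachingCircle (circlePt t)).1 = c / 2 := (hKc (circlePt t)).2
  have hflat : ‖cx (f.attachingCircle (circlePt t)).1‖ ^ 2 < 4 := (hKc (circlePt t)).1
  have e : fderiv ℝ (fun v : EuclideanSpace ℝ (Fin 2) => (f.toFun (depthLine (circlePt t) v 0)).1) 0 m' =
      (a 0 * r) • cplxJ (deriv (ambCurve g f.attachingCircle) t) +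
        (a 1 * κ) • rotField g (f.attachingCircle (circlePt t)).1 +
        c₀ • deriv (ambCurve g f.attachingCircle) t := by
    rw [hc₀]
    show c₀ • deriv (ambCurve g f.attachingCircle) t + (a 0 • (r • cplxJ (deriv (ambCurve g f.attachingCircle) t)) +
      a 1 • (κ • rotField g (f.attachingCircle (circlePt t)).1)) = _
    rw [smul_smul, smul_smul]
    abel
  rw [e, pageSlope_coeff_of_pageFrame hc hw hflat hT]
  ring

/-- **Sub-goal `helper_beltRows_pageTube` of stub `stub_T3_dualPresentation`** (T3 ▸ node `Hgap` ▸ part B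
`helper_Hgap_twisting`, brick G2-1 tube side II; wave 6, lead c5): through Z4's page tube the page-rescaled
normal component of the fibre derivative of the attaching tube is `κ · (A m')₁`, the second row of the
transition matrix. [cite: EtnyreFuller2006, Thm. 1 (proof, p. 8)] -/
theorem helper_beltRows_pageTube : ∀ (g : ℕ) (f : Literature.Topology.FourManifolds.HandleAttachingMap 3 2 (Literature.Topology.FourManifolds.LefschetzBase.Base g)) (c : ℂ), ‖c‖ = 1 → (∀ θ, f.attachingCircle θ ∈ Literature.Topology.FourManifolds.LefschetzBase.page g c) → ∀ (κ r : ℝ) (Φ : Literature.Topology.FourManifolds.CircleTube (Literature.Topology.FourManifolds.LefschetzBase.bBase g).carrier), (∀ ψ, (Literature.Topology.FourManifolds.LefschetzBase.bBase g).incl (Φ.core ψ) = f.attachingCircle ψ) → (∀ t : ℝ, HasFDerivAt (fun v : EuclideanSpace ℝ (Fin 2) => ((Literature.Topology.FourManifolds.LefschetzBase.bBase g).incl (Φ.toHomeo (Literature.Topology.FourManifolds.circlePt t, v))).1) ((EuclideanSpace.proj (𝕜 := ℝ) (0 : Fin 2)).smulRight (r • Literature.Topology.FourManifolds.LefschetzBase.cplxJ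 (deriv (Literature.Topology.FourManifolds.LefschetzBase.ambCurve g f.attachingCircle) t)) + (EuclideanSpace.proj (𝕜 := ℝ) (1 : Fin 2)).smulRight (κ • Summit.SmoothPoincare4.SmoothPoincare4.Theorems.AcyclicBisectionExists.ModpBraidOrbits.rotField g (f.attachingCircle (Literature.Topology.FourManifolds.circlePt t)).1)) 0) → ∀ (t : ℝ) (m' : EuclideanSpace ℝ (Fin 2)), 4 * (‖Literature.Topology.FourManifolds.LefschetzBase.dPhiX g (f.attachingCircle (Literature.Topology.FourManifolds.circlePt t)).1‖ ^ 2 + ‖Literature.Topology.FourManifolds.LefschetzBase.dPhiY (f.attachingCircle (Literature.Topology.FourManifolds.circlePt t)).1‖ ^ 2) * inner ℝ (fderiv ℝ (fun v : EuclideanSpace ℝ (Fin 2) => (f.toFun (Literature.Topology.FourManifolds.depthLine (Literature.Topology.FourManifolds.circlePt t) v 0)).1) 0 m') (Literature.Topology.FourManifolds.LefschetzBase.horizNormal g (f.attachingCircle (Literature.Topology.FourManifolds.circlePt t)).1) = κ * (Literature.Topology.FourManifolds.CircleTube.fibreDeriv f.boundaryTube Φ (Literature.Topology.FourManifolds.circlePt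 t) m') 1 :=
  fun _ f _ hc hKc _ _ _ hΦcore hΦder t m' => beltRow_eq_pageTube f hc hKc hΦcore hΦder t m'

end Summit.SmoothPoincare4.SmoothPoincare4.Theorems.AcyclicBisectionExists.ModpBraidOrbits

end
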